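import Summits.BirchSwinnertonDyer.BirchSwinnertonDyer.Theorems.SignedLowerHalvesSmallImageLowerHalfBothSignsRttCharRoadE1LocalSquareData
import Summits.BirchSwinnertonDyer.BirchSwinnertonDyer.Theorems.QuadraticBranchSignedControlEtaLayerPackages
import Summits.BirchSwinnertonDyer.BirchSwinnertonDyer.Theorems.GenusKolyvaginAtTwoPowDvdShaCardAtTwoRTLocalDegreeQuadratic
import HarnessLib

/-!
# Route `SignedLowerHalves`, crux L `SmallImageLowerHalfBothSigns` (stmt-BirchSwinnertonDyer-23599), line `rtt_w3` v11 — brick D3-W, CONCRETE HALF,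
# part 6 (memo `Lines/rtt_w3-MEMO-D3c-w3g17.md` §7): THE LOCAL SQUARE AT AN INERT PRIME OF A QUADRATIC FIELD `K/ℚ`, INSTANTIATED —
# for `w` the place of `K` with `w = (p)` (INJ's hypothesis `v.asIdeal = span {p}`) over a place `v₀ ∋ p` of `ℚ`: the embedding
# `K_{v₀=p} → K_w` is NOT onto (local degree `e·f = 2`), hence the package of cell bsd-potss (`EtaLayer.exists_package_adicCompletion_of_embedding`)
# at the `K`-side embedding `closureEmb K_w` comes WITH an element of `Γ_{ℚ_p}` restricting outside `galRange K`, and so with the Frobenius-type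
# elements `c ∈ Λ_n` of parts 1–5 at every layer.

Width seat `bsd-line-slh-p3-w3` g17 under LEAD `cruxlead-stmt-BirchSwinnertonDyer-23599` (cell `bsd-ssimc`; `--supports stmt-BirchSwinnertonDyer-23599 --as helper`).
THEOREMS ONLY (no definition, no named fact, no instance, no `sorry`). BSD / crux L / INJ are NOT proved here.

* `liesOver_span_int_of_eq_span` — `w ∣ (p) ⊆ ℤ`; `ncard_primesOver_le_one_of_eq_span` — `w` is the only prime of `K` over `p`.
* `not_surjective_adicCompletionMap_of_eq_span` — `[K_w : ℚ_{v₀}] = e·f = 2` (tree: `GenusExact.PlusDescent.finrank_adicCompletionMap_eq_…`,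
  `…ramificationIdx_mul_inertiaDeg_eq_two_of_ncard_primesOver_ne_two`), so `ℚ_{v₀} → K_w` is not onto.
* ★ `exists_localSquare_of_eq_span` — the square `(ι, ι₂)` for `ι' = closureEmb K_w` with `ι' ∘ ι_K = ι₂ ∘ ι`, `ι₂|_{ℚ_{v₀}} = (ℚ_{v₀} → K_w)`,
  the fixing hypothesis for `galRange K`, AND `τ ∈ Γ_{ℚ_{v₀}}` with `res_ι τ ∉ galRange K`.
* ★ `exists_localSquare_layers_of_eq_span` — the same plus, for `p` odd and any `ℤ_p`-extension `κ` of `ℚ`, at every layer `n` an element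
  `c ∈ localSubgroupOfEmb (κ.layerSubgroup n) ι` with `res_ι c ∉ galRange K` (parts 4–5, `…E1LocalAtP`, `…E1LocalCores` consume exactly this).

References: [NeukirchANT1999] II (8.5), II §9; [SerreGaloisCohomology1997] II §1.1; [Washington1997] §13.1.
-/

set_option autoImplicit false
set_option linter.dupNamespace false -- D-0017: single-problem summit, the namespace repeats the problem name by design
noncomputable section

open scoped Classical

namespace Summit.BirchSwinnertonDyer.BirchSwinnertonDyer.Theorems.SmallImageCharSignedSelmer

open NumberField IsDedekindDomain Literature.NumberTheory.EllipticCurves Literature.NumberTheory.GaloisRepresentations Field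
  Summit.BirchSwinnertonDyer.Rank1Residual.Additive.LocalTransport

section Inert

variable (K : Type) [Field K] [NumberField K] {p : ℕ} [hp : Fact p.Prime]
  (v₀ : HeightOneSpectrum (𝓞 ℚ)) (w : HeightOneSpectrum (𝓞 K)) (hw : w.asIdeal = Ideal.span {(p : 𝓞 K)})

omit [NumberField K] in
include hw in
/-- `w ∣ (p) ⊆ ℤ` when `w = (p) ⊆ 𝓞_K`: `(p) ≤ w ∩ ℤ ≠ ℤ` and `(p)` is maximal. [cite: NeukirchANT1999, I §8] -/
theorem liesOver_span_int_of_eq_span : w.asIdeal.LiesOver (Ideal.span {(p : ℤ)}) := by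
  have hprime : (Ideal.span {(p : ℤ)}).IsPrime :=
    (Ideal.span_singleton_prime (by exact_mod_cast hp.out.ne_zero)).mpr (Nat.prime_iff_prime_int.mp hp.out)
  have hmax : (Ideal.span {(p : ℤ)}).IsMaximal :=
    hprime.isMaximal (by rw [Ne, Ideal.span_singleton_eq_bot]; exact_mod_cast hp.out.ne_zero)
  refine ⟨hmax.eq_of_le (Ideal.comap_ne_top _ w.isPrime.ne_top) ?_⟩
  rw [Ideal.span_singleton_le_iff_mem, Ideal.mem_comap, map_natCast, hw]
  exact Ideal.subset_span rfl

omit hp in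
include hw in
/-- `w` is the only prime of `𝓞_K` over `p` when `w = (p)`: a prime over `p` contains `p𝓞_K = w`, which is maximal. [cite: NeukirchANT1999, I §8] -/
theorem ncard_primesOver_le_one_of_eq_span : ((Ideal.span {(p : ℤ)}).primesOver (𝓞 K)).ncard ≤ 1 := by
  have hsub : (Ideal.span {(p : ℤ)}).primesOver (𝓞 K) ⊆ {w.asIdeal} := by
    rintro P ⟨hP, hPover⟩
    rw [Set.mem_singleton_iff]
    have hpP : (p : 𝓞 K) ∈ P := by
      have h : (p : ℤ) ∈ P.under ℤ := hPover.over ▸ Ideal.subset_span rfl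
      rw [Ideal.mem_comap, map_natCast] at h
      exact h
    have hle : w.asIdeal ≤ P := by
      rw [hw, Ideal.span_singleton_le_iff_mem]
      exact hpP
    exact (w.isMaximal.eq_of_le hP.ne_top hle).symm
  calc ((Ideal.span {(p : ℤ)}).primesOver (𝓞 K)).ncard ≤ ({w.asIdeal} : Set (Ideal (𝓞 K))).ncard :=
      Set.ncard_le_ncard hsub (Set.finite_singleton _)
    _ = 1 := Set.ncard_singleton _

include hw in
/-- **`ℚ_{v₀} → K_w` is not onto at the inert prime** (`[K : ℚ] = 2`, `w = (p)` over `v₀`): the local degree is `e(w|p)·f(w|p) = 2 ≠ 1`.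
[cite: NeukirchANT1999, II (8.5)] -/
theorem not_surjective_adicCompletionMap_of_eq_span (hK2 : Module.finrank ℚ K = 2) [w.asIdeal.LiesOver v₀.asIdeal] :
    ¬ Function.Surjective (adicCompletionMap (K := ℚ) K v₀ w) := by
  haveI := liesOver_span_int_of_eq_span K w hw
  haveI : w.asIdeal.IsPrime := w.isPrime
  letI : Algebra (v₀.adicCompletion ℚ) (w.adicCompletion K) := (adicCompletionMap (K := ℚ) K v₀ w).toAlgebra
  have hfin := GenusExact.PlusDescent.finrank_adicCompletionMap_eq_ramificationIdx_mul_inertiaDeg K v₀ w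
  have hne : ((Ideal.span {(p : ℤ)}).primesOver (𝓞 K)).ncard ≠ 2 := by
    have h := ncard_primesOver_le_one_of_eq_span K w hw
    omega
  rw [GenusExact.PlusDescent.ramificationIdx_mul_inertiaDeg_eq_two_of_ncard_primesOver_ne_two hK2 hp.out hne w.asIdeal] at hfin
  exact not_surjective_of_finrank_ne_one (adicCompletionMap (K := ℚ) K v₀ w) (fun _ ↦ rfl) (by rw [hfin]; decide)

include hw in
/-- ★ **The local square at the inert prime, with an element moving `K`.** For `[K : ℚ] = 2`, `w = (p)` over `v₀`: there are a
`ℚ`-embedding `ι : ℚ̄ → \bar{ℚ_{v₀}}` and `ι₂ : \bar{ℚ_{v₀}} ≃ \bar{K_w}` with `closureEmb K_w ∘ ι_K = ι₂ ∘ ι`, `ι₂|_{ℚ_{v₀}} = (ℚ_{v₀} → K_w)`, the fixing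
hypothesis for `galRange K` (cell bsd-potss's package at `ι' = closureEmb K_w`), and some `τ ∈ Γ_{ℚ_{v₀}}` with `res_ι τ ∉ galRange K`
(`K_w = ℚ_{v₀}·K ≠ ℚ_{v₀}`, `exists_resGalOfEmb_not_mem_galRange`). [cite: SerreGaloisCohomology1997, II §1.1] [cite: NeukirchANT1999, II §8–§9] -/
theorem exists_localSquare_of_eq_span (hK2 : Module.finrank ℚ K = 2) [w.asIdeal.LiesOver v₀.asIdeal] :
    ∃ (ι : AlgebraicClosure ℚ →ₐ[ℚ] AlgebraicClosure (v₀.adicCompletion ℚ))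
      (ι₂ : AlgebraicClosure (v₀.adicCompletion ℚ) ≃+* AlgebraicClosure (w.adicCompletion K)),
      (∀ z : AlgebraicClosure ℚ, closureEmb (K := K) (w.adicCompletion K) (closureEmb (K := ℚ) K z) = ι₂ (ι z)) ∧
      (∀ y : v₀.adicCompletion ℚ, ι₂ (algebraMap (v₀.adicCompletion ℚ) (AlgebraicClosure (v₀.adicCompletion ℚ)) y) =
        algebraMap (w.adicCompletion K) (AlgebraicClosure (w.adicCompletion K)) (adicCompletionMap (K := ℚ) K v₀ w y)) ∧
      (∀ h : absoluteGaloisGroup (v₀.adicCompletion ℚ), resGalOfEmb ι h ∈ galRange (K := ℚ) K → ∀ y : w.adicCompletion K,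
        (show AlgebraicClosure (v₀.adicCompletion ℚ) ≃ₐ[v₀.adicCompletion ℚ] AlgebraicClosure (v₀.adicCompletion ℚ) from h)
            (ι₂.symm (algebraMap (w.adicCompletion K) (AlgebraicClosure (w.adicCompletion K)) y)) =
          ι₂.symm (algebraMap (w.adicCompletion K) (AlgebraicClosure (w.adicCompletion K)) y)) ∧
      ∃ τ : absoluteGaloisGroup (v₀.adicCompletion ℚ), resGalOfEmb ι τ ∉ galRange (K := ℚ) K := by
  obtain ⟨ι, ι₂, hcompat, hf, hfix⟩ := EtaLayer.exists_package_adicCompletion_of_embedding (E := v₀.adicCompletion ℚ) K v₀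
    (RingEquiv.refl _) (fun _ ↦ rfl) w (closureEmb (K := K) (w.adicCompletion K))
  have hf' : ∀ y : v₀.adicCompletion ℚ, ι₂ (algebraMap (v₀.adicCompletion ℚ) (AlgebraicClosure (v₀.adicCompletion ℚ)) y) =
      algebraMap (w.adicCompletion K) (AlgebraicClosure (w.adicCompletion K)) (adicCompletionMap (K := ℚ) K v₀ w y) := fun y ↦ by
    rw [hf y]; rfl
  obtain ⟨θ₀, hθ₀⟩ := exists_algebraMap_not_mem_range K (adicCompletionMap (K := ℚ) K v₀ w)
    (closure_range_adicCompletionMap_union_eq_top K v₀ w) (not_surjective_adicCompletionMap_of_eq_span K v₀ w hw hK2)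
  exact ⟨ι, ι₂, hcompat, hf', hfix, exists_resGalOfEmb_not_mem_galRange_of_charZero K ι ι₂ (closureEmb (K := K) (w.adicCompletion K))
    hcompat (adicCompletionMap (K := ℚ) K v₀ w) hf' hθ₀⟩

include hw in
/-- ★ **… and a Frobenius-type element in every layer** (`p` odd, `κ` any `ℤ_p`-extension of `ℚ`): besides the square and its fixing hypothesis,
at every `n` an element `c ∈ Λ_n = localSubgroupOfEmb (κ.layerSubgroup n) ι` with `res_ι c ∉ galRange K` (`c = τ^{pⁿ}`,
`exists_mem_localSubgroupOfEmb_layerSubgroup_not_mem` with `[Γ_ℚ : galRange K] = 2`). These are the data `(ι, ι₂, hcompat, hι₂, hfixU, c)` of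
`…E1LocalAtP` / `…E1LocalCores` at the inert prime. [cite: NeukirchANT1999, II §9] [cite: Washington1997, §13.1] -/
theorem exists_localSquare_layers_of_eq_span (hK2 : Module.finrank ℚ K = 2) [w.asIdeal.LiesOver v₀.asIdeal] (hp2 : p ≠ 2)
    (κ : ZpExtension ℚ p) :
    ∃ (ι : AlgebraicClosure ℚ →ₐ[ℚ] AlgebraicClosure (v₀.adicCompletion ℚ))
      (ι₂ : AlgebraicClosure (v₀.adicCompletion ℚ) ≃+* AlgebraicClosure (w.adicCompletion K)),
      (∀ z : AlgebraicClosure ℚ, closureEmb (K := K) (w.adicCompletion K) (closureEmb (K := ℚ) K z) = ι₂ (ι z)) ∧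
      (∀ y : v₀.adicCompletion ℚ, ι₂ (algebraMap (v₀.adicCompletion ℚ) (AlgebraicClosure (v₀.adicCompletion ℚ)) y) =
        algebraMap (w.adicCompletion K) (AlgebraicClosure (w.adicCompletion K)) (adicCompletionMap (K := ℚ) K v₀ w y)) ∧
      (∀ h : absoluteGaloisGroup (v₀.adicCompletion ℚ), resGalOfEmb ι h ∈ galRange (K := ℚ) K → ∀ y : w.adicCompletion K,
        (show AlgebraicClosure (v₀.adicCompletion ℚ) ≃ₐ[v₀.adicCompletion ℚ] AlgebraicClosure (v₀.adicCompletion ℚ) from h)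
            (ι₂.symm (algebraMap (w.adicCompletion K) (AlgebraicClosure (w.adicCompletion K)) y)) =
          ι₂.symm (algebraMap (w.adicCompletion K) (AlgebraicClosure (w.adicCompletion K)) y)) ∧
      ∀ n : ℕ, ∃ c ∈ localSubgroupOfEmb (κ.layerSubgroup n) ι, resGalOfEmb ι c ∉ galRange (K := ℚ) K := by
  obtain ⟨ι, ι₂, hcompat, hf, hfix, τ, hτ⟩ := exists_localSquare_of_eq_span K v₀ w hw hK2
  exact ⟨ι, ι₂, hcompat, hf, hfix, fun n ↦
    exists_mem_localSubgroupOfEmb_layerSubgroup_not_mem κ ι hp2 (index_galRange_eq_two K hK2) hτ n⟩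

end Inert

end Summit.BirchSwinnertonDyer.BirchSwinnertonDyer.Theorems.SmallImageCharSignedSelmer

end
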